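import Summits.QuantumAdvantage.QuantumAdvantage.Theorems.SosSandwichPseudoBoundedAACompletelyBoundedCorner
import Summits.QuantumAdvantage.QuantumAdvantage.Theorems.SosSandwichTopHomogeneousFourier
import HarnessLib

/-!
# Crux `PseudoBoundedAA` (stmt-QuantumAdvantage-15237) / support `HomogeneousPBAAT` (stmt-27399) — the
# COMPLETELY-BOUNDED CORNER, part 3: single-level (homogeneous) inputs lose NO degree, and the address family is far
# outside the corner

Part 2 (`…CompletelyBoundedCorner`) proved the root-influence inequality `W_D[p] ≤ K·√(maxⱼ Inf_j^{=D})` for every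
level `D` of a polynomial whose ORDERED COMPLETELY BOUNDED NORM is `≤ K`, and paid a factor `deg²` to locate a heavy
level.  When the centred part of `p` lives on ONE level `D` (Escudero Gutiérrez's homogeneous case, Remark 4.2:
optimal constant) nothing is lost:

* `exists_influence_ge_of_levelWeight` — the engine: `W_D ≥ w > 0` and ordered cb-norm `≤ K` give
  `∃ i, 4(w/K)² ≤ Infᵢ[p]`;
* `exists_influence_ge_of_cb_singleLevel` — if `p̂(S) = 0` for all `S ≠ ∅` with `|S| ≠ D`, then `Var = W_D` and
  `∃ i, 4(ε/K)² ≤ Infᵢ[p]` for `0 < ε ≤ Var[p]` — NO dependence on the degree;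
* `homogeneousPBAAT_cbCorner` — the route's top-homogeneous class (Laplacian eigen-equation
  `Σᵢ (p − p∘flipᵢ) = 4T (p − E p)`, i.e. centred part on level `2T`, file `…TopHomogeneousFourier`) with ordered
  cb-norm `≤ K`: `∃ i, 4·Var²/K² ≤ Infᵢ[p]`, `T`-free — so the body of `HomogeneousPBAAT` holds on the corner with
  `(c, C) = (2, 4/K²)` (`homogeneousPBAAT_cbCorner_literal`, `K = 1`, literal inline vocabulary);
* `cbNorm_ge_of_flat_influences` — CALIBRATION, read contrapositively: a top-homogeneous `p` with `Var ≥ ε` and all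
  influences `≤ I₀` has ordered cb-norm `K` with `K²·I₀ ≥ 4ε²`.  On the self-composed ADDRESS FAMILY that refuted the
  degree-free `HomogeneousPBAA` (`Theorems.SosSandwich.not_HomogeneousPBAA`: order `T = 2^k`, `Var = 1/4`, every
  influence `= 1/T`) this forces `K ≥ √T/2`: the refuting family lies at ordered-cb distance `√T` from the corner,
  which is exactly why the corner's `T`-free law does not contradict the refutation.

Honest label: corollaries of a published special case (EG23 Thm. 1.8 / BSdW22 Thm. 1.3) in kernel form,
`--supports` the open crux; no stub, crux or summit is closed.
Sources: EscuderoGutierrez2023 (arXiv:2304.06713) Thm. 1.8, Remarks 4.1–4.2; BansalSinhaDeWolf2022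
(arXiv:2203.00212) Thm. 1.3–1.4; ODonnell2014 §1.4, §2.3.
-/

-- D-0017: single-conjunct summit ⇒ the duplicate `QuantumAdvantage.QuantumAdvantage` is mandated.
set_option linter.dupNamespace false

noncomputable section

open Finset Matrix
open Literature.Computability.QuantumComplexity
open Literature.Computability.Complexity.LowDegree (cubeFourierCoeff)

namespace Summit.QuantumAdvantage.QuantumAdvantage.Theorems.SosSandwich.CompletelyBoundedCorner

variable {N : ℕ}

/-- **The engine**: if the ordered completely bounded norm of `p` is `≤ K` and the level-`D` weight
`W_D = Σ_{|S|=D} p̂(S)²` (`D ≥ 1`) is at least `w > 0`, then some variable has `Infᵢ[p] ≥ 4(w/K)²`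
(root-influence inequality with `M = maxⱼ Inf_j^{=D}`, then `Infⱼ = 4Σ_{S∋j} p̂(S)² ≥ 4 Inf_j^{=D}`).
[cite: EscuderoGutierrez2023, Thm. 1.8 (Eq. (23))] [cite: BansalSinhaDeWolf2022, Thm. 1.4] -/
theorem exists_influence_ge_of_levelWeight (p : MvPolynomial (Fin N) ℝ) {K : ℝ} (hK : 0 < K)
    (hcb : ∀ (m : ℕ) (A : Fin N → Matrix (Fin m) (Fin m) ℝ) (v f : Fin m → ℝ),
      (∀ j w, ∑ a, (A j *ᵥ w) a ^ 2 ≤ ∑ a, w a ^ 2) → ∑ a, v a ^ 2 = 1 → ∑ a, f a ^ 2 = 1 →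
      f ⬝ᵥ ((∑ S : Finset (Fin N), cubeFourierCoeff (evalBool p) S • ((S.sort).map A).prod) *ᵥ v) ≤ K)
    {D : ℕ} (hD : 1 ≤ D) {w : ℝ} (hw : 0 < w)
    (hW : w ≤ ∑ S with S.card = D, cubeFourierCoeff (evalBool p) S ^ 2) :
    ∃ i : Fin N, 4 * (w / K) ^ 2 ≤ influence i p := by
  classical
  set g : Finset (Fin N) → ℝ := cubeFourierCoeff (evalBool p) with hg
  have hWpos : 0 < ∑ S with S.card = D, g S ^ 2 := lt_of_lt_of_le hw hW
  -- a set of size `D` with nonzero coefficient, hence a variable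
  obtain ⟨S₀, hS₀, hgS₀⟩ := Finset.exists_ne_zero_of_sum_ne_zero hWpos.ne'
  have hS₀D : S₀.card = D := (Finset.mem_filter.mp hS₀).2
  obtain ⟨j₀, hj₀⟩ : S₀.Nonempty := Finset.card_pos.mp (by omega)
  -- the largest level-`D` influence
  set I : Fin N → ℝ := fun j => ∑ S with (S.card = D ∧ j ∈ S), g S ^ 2 with hI
  obtain ⟨jm, -, hjm⟩ := Finset.exists_max_image Finset.univ I ⟨j₀, Finset.mem_univ _⟩
  have hIj₀ : g S₀ ^ 2 ≤ I j₀ := by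
    rw [hI]
    exact Finset.single_le_sum (f := fun S => g S ^ 2) (fun _ _ => sq_nonneg _)
      (Finset.mem_filter.mpr ⟨Finset.mem_univ _, hS₀D, hj₀⟩)
  have hMpos : 0 < I jm := by
    have h1 : 0 < g S₀ ^ 2 := lt_of_le_of_ne (sq_nonneg _) (Ne.symm hgS₀)
    exact lt_of_lt_of_le (lt_of_lt_of_le h1 hIj₀) (hjm j₀ (Finset.mem_univ _))
  -- root-influence inequality
  have hroot : ∑ S with S.card = D, g S ^ 2 ≤ K * √(I jm) :=
    levelWeight_le p hcb hD hMpos fun j => hjm j (Finset.mem_univ j)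
  have hsq : w ^ 2 ≤ K ^ 2 * I jm := by
    have h := mul_self_le_mul_self hw.le (hW.trans hroot)
    rw [← sq, ← sq, mul_pow, Real.sq_sqrt hMpos.le] at h
    exact h
  have hinf : 4 * I jm ≤ influence jm p := by
    rw [influence_eq_sum_sq_fourier, ← hg]
    have : I jm ≤ ∑ S with jm ∈ S, g S ^ 2 := by
      rw [hI]
      exact Finset.sum_le_sum_of_subset_of_nonneg
        (fun S hS => Finset.mem_filter.mpr ⟨Finset.mem_univ _, (Finset.mem_filter.mp hS).2.2⟩)
        fun _ _ _ => sq_nonneg _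
    linarith
  refine ⟨jm, le_trans ?_ hinf⟩
  have h4 : w ^ 2 / K ^ 2 ≤ I jm := by rw [div_le_iff₀ (pow_pos hK 2)]; linarith
  rw [div_pow]
  linarith

/-- **Single-level inputs lose no degree** (Escudero Gutiérrez's homogeneous case, optimal constant): if
`p̂(S) = 0` for every nonempty `S` of size `≠ D` (`D ≥ 1`), then `Var[p] = W_D` and an ordered cb-norm `≤ K`
gives `∃ i, 4(ε/K)² ≤ Infᵢ[p]` whenever `0 < ε ≤ Var[p]`. [cite: EscuderoGutierrez2023, Thm. 1.8, Remark 4.2] -/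
theorem exists_influence_ge_of_cb_singleLevel {D : ℕ} (hD : 1 ≤ D) (p : MvPolynomial (Fin N) ℝ)
    (hhom : ∀ S : Finset (Fin N), S ≠ ∅ → S.card ≠ D → cubeFourierCoeff (evalBool p) S = 0)
    {K : ℝ} (hK : 0 < K)
    (hcb : ∀ (m : ℕ) (A : Fin N → Matrix (Fin m) (Fin m) ℝ) (v f : Fin m → ℝ),
      (∀ j w, ∑ a, (A j *ᵥ w) a ^ 2 ≤ ∑ a, w a ^ 2) → ∑ a, v a ^ 2 = 1 → ∑ a, f a ^ 2 = 1 →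
      f ⬝ᵥ ((∑ S : Finset (Fin N), cubeFourierCoeff (evalBool p) S • ((S.sort).map A).prod) *ᵥ v) ≤ K)
    {ε : ℝ} (hε : 0 < ε) (hvar : ε ≤ boolVariance p) :
    ∃ i : Fin N, 4 * (ε / K) ^ 2 ≤ influence i p := by
  classical
  set g : Finset (Fin N) → ℝ := cubeFourierCoeff (evalBool p) with hg
  -- `Σ_S ĝ(S)² = ĝ(∅)² + W_D`
  have hpt : ∀ S : Finset (Fin N),
      g S ^ 2 = (if S = ∅ then g ∅ ^ 2 else 0) + (if S.card = D then g S ^ 2 else 0) := by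
    intro S
    by_cases h0 : S = ∅
    · subst h0; rw [if_pos rfl, Finset.card_empty, if_neg (by omega), add_zero]
    · rw [if_neg h0, zero_add]
      by_cases hc : S.card = D
      · rw [if_pos hc]
      · rw [if_neg hc, hhom S h0 hc]; ring
  have hsum : ∑ S, g S ^ 2 = g ∅ ^ 2 + ∑ S with S.card = D, g S ^ 2 := by
    rw [Finset.sum_congr rfl fun S _ => hpt S, Finset.sum_add_distrib, Finset.sum_ite_eq' Finset.univ ∅,
      if_pos (Finset.mem_univ _), Finset.sum_filter]
  have hvarW : boolVariance p = ∑ S with S.card = D, g S ^ 2 := by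
    rw [SpectralCorner.boolVariance_eq_sum_sq_sub_empty, ← hg, hsum]; ring
  exact exists_influence_ge_of_levelWeight p hK hcb hD hε (hvarW ▸ hvar)

/-- **`HomogeneousPBAAT` on the completely-bounded corner, `T`-free.**  If `p` satisfies the Laplacian
eigen-equation `Σᵢ (p(x) − p(xⁱ)) = 4T (p(x) − E p)` (centred part on Walsh level `2T`, `T ≥ 1`) and has ordered
cb-norm `≤ K`, then `∃ i, 4·Var[p]²/K² ≤ Infᵢ[p]` (pseudo-boundedness is not even used).
[cite: EscuderoGutierrez2023, Thm. 1.8, Remark 4.2] [cite: ODonnell2014, §2.3] -/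
theorem homogeneousPBAAT_cbCorner {T : ℕ} (hT : 1 ≤ T) (p : MvPolynomial (Fin N) ℝ)
    (hL : ∀ x : Fin N → Bool, ∑ i : Fin N, (evalBool p x - evalBool p (Function.update x i (!x i))) =
      4 * (T : ℝ) * (evalBool p x - boolAvg (evalBool p)))
    {K : ℝ} (hK : 0 < K)
    (hcb : ∀ (m : ℕ) (A : Fin N → Matrix (Fin m) (Fin m) ℝ) (v f : Fin m → ℝ),
      (∀ j w, ∑ a, (A j *ᵥ w) a ^ 2 ≤ ∑ a, w a ^ 2) → ∑ a, v a ^ 2 = 1 → ∑ a, f a ^ 2 = 1 →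
      f ⬝ᵥ ((∑ S : Finset (Fin N), cubeFourierCoeff (evalBool p) S • ((S.sort).map A).prod) *ᵥ v) ≤ K)
    (hvar : 0 < boolVariance p) :
    ∃ i : Fin N, 4 * (boolVariance p / K) ^ 2 ≤ influence i p :=
  exists_influence_ge_of_cb_singleLevel (D := 2 * T) (by omega) p
    (fun _ hS0 hS => TopLevelFourier.cubeFourierCoeff_eq_zero_of_laplacian T p hL hS0 hS) hK hcb hvar le_rfl

/-- **The same in the literal inline vocabulary of the route decl `HomogeneousPBAAT`** (stmt-QuantumAdvantage-27399;
its `let ev`, `let avg`, inline SOS certificate, Laplacian eigen-equation): on the completely-bounded corner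
(ordered cb-norm `≤ 1`) the body of `HomogeneousPBAAT` holds with `(c, C) = (2, 4)` — indeed `T`-free, since
`(Var/T)² ≤ Var²`. [cite: EscuderoGutierrez2023, Thm. 1.8, Remark 4.2] [cite: AaronsonAmbainis2014, Conj. 6] -/
theorem homogeneousPBAAT_cbCorner_literal (N T : ℕ) (p : MvPolynomial (Fin N) ℝ)
    (hcb : ∀ (m : ℕ) (A : Fin N → Matrix (Fin m) (Fin m) ℝ) (v f : Fin m → ℝ),
      (∀ j w, ∑ a, (A j *ᵥ w) a ^ 2 ≤ ∑ a, w a ^ 2) → ∑ a, v a ^ 2 = 1 → ∑ a, f a ^ 2 = 1 →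
      f ⬝ᵥ ((∑ S : Finset (Fin N), cubeFourierCoeff (evalBool p) S • ((S.sort).map A).prod) *ᵥ v) ≤ 1) :
    let ev : MvPolynomial (Fin N) ℝ → (Fin N → Bool) → ℝ :=
      fun f x => MvPolynomial.eval (fun k => if x k then (1 : ℝ) else 0) f
    let avg : ((Fin N → Bool) → ℝ) → ℝ := fun g => (∑ x : Fin N → Bool, g x) / (2 : ℝ) ^ N
    1 ≤ T →
    (∃ (m : ℕ) (q r : Fin m → MvPolynomial (Fin N) ℝ),
        (∀ j, (q j).totalDegree ≤ T ∧ (r j).totalDegree ≤ T) ∧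
          ∀ x : Fin N → Bool, ev p x = ∑ j, ev (q j) x ^ 2 ∧ 1 - ev p x = ∑ j, ev (r j) x ^ 2) →
    (∀ x : Fin N → Bool, ∑ i : Fin N, (ev p x - ev p (Function.update x i (!x i))) =
      4 * (T : ℝ) * (ev p x - avg (ev p))) →
    0 < (avg fun x => (ev p x - avg (ev p)) ^ 2) →
    ∃ i : Fin N, 4 * ((avg fun x => (ev p x - avg (ev p)) ^ 2) / (T : ℝ)) ^ 2 ≤
      (avg fun x => (ev p x - ev p (Function.update x i (!x i))) ^ 2) := by
  intro ev avg hT _ hL hv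
  change ∀ x : Fin N → Bool, ∑ i : Fin N, (evalBool p x - evalBool p (Function.update x i (!x i))) =
      4 * (T : ℝ) * (evalBool p x - boolAvg (evalBool p)) at hL
  change 0 < boolVariance p at hv
  change ∃ i : Fin N, 4 * (boolVariance p / (T : ℝ)) ^ 2 ≤ influence i p
  obtain ⟨i, hi⟩ := homogeneousPBAAT_cbCorner hT p hL one_pos hcb hv
  refine ⟨i, le_trans ?_ hi⟩
  have hT1 : (1 : ℝ) ≤ T := by exact_mod_cast hT
  have h1 : boolVariance p / (T : ℝ) ≤ boolVariance p / 1 :=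
    div_le_div_of_nonneg_left hv.le one_pos hT1
  have h0 : 0 ≤ boolVariance p / (T : ℝ) := div_nonneg hv.le (by positivity)
  nlinarith [mul_le_mul h1 h1 h0 (by positivity)]

/-- **Calibration — how far the refuting address family is from the corner.**  A top-homogeneous `p` (Laplacian
eigen-equation at order `T ≥ 1`) with ordered cb-norm `≤ K`, `Var[p] ≥ ε > 0` and ALL influences `≤ I₀` satisfies
`4ε² ≤ K²·I₀`.  For the self-composed address family of `not_HomogeneousPBAA` (`Var = 1/4`, every influence `= 1/T`)
this reads `K² ≥ T/4`: its ordered completely bounded norm is at least `√T/2`.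
[cite: EscuderoGutierrez2023, Thm. 1.8, Remark 4.2] -/
theorem cbNorm_ge_of_flat_influences {T : ℕ} (hT : 1 ≤ T) (p : MvPolynomial (Fin N) ℝ)
    (hL : ∀ x : Fin N → Bool, ∑ i : Fin N, (evalBool p x - evalBool p (Function.update x i (!x i))) =
      4 * (T : ℝ) * (evalBool p x - boolAvg (evalBool p)))
    {K : ℝ} (hK : 0 < K)
    (hcb : ∀ (m : ℕ) (A : Fin N → Matrix (Fin m) (Fin m) ℝ) (v f : Fin m → ℝ),
      (∀ j w, ∑ a, (A j *ᵥ w) a ^ 2 ≤ ∑ a, w a ^ 2) → ∑ a, v a ^ 2 = 1 → ∑ a, f a ^ 2 = 1 →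
      f ⬝ᵥ ((∑ S : Finset (Fin N), cubeFourierCoeff (evalBool p) S • ((S.sort).map A).prod) *ᵥ v) ≤ K)
    {ε : ℝ} (hε : 0 < ε) (hvar : ε ≤ boolVariance p) {I₀ : ℝ} (hI : ∀ i : Fin N, influence i p ≤ I₀) :
    4 * ε ^ 2 ≤ K ^ 2 * I₀ := by
  obtain ⟨i, hi⟩ := exists_influence_ge_of_cb_singleLevel (D := 2 * T) (by omega) p
    (fun _ hS0 hS => TopLevelFourier.cubeFourierCoeff_eq_zero_of_laplacian T p hL hS0 hS) hK hcb hε hvar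
  have h := hi.trans (hI i)
  rw [div_pow] at h
  have hK2 : 0 < K ^ 2 := pow_pos hK 2
  have : 4 * ε ^ 2 / K ^ 2 ≤ I₀ := by rw [mul_div_assoc]; exact h
  rwa [div_le_iff₀ hK2, mul_comm I₀] at this

end Summit.QuantumAdvantage.QuantumAdvantage.Theorems.SosSandwich.CompletelyBoundedCorner

end
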